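import Summits.HodgeConjecture.HodgeConjecture.Theorems.Ring2WeilCoverageResidueDictionaryPiecesB
import HarnessLib

/-!
# Weil-type family coverage — the RESIDUE DICTIONARY, rows: at the levels `21, 28, 32, 36, 40, 48, 60` every displayed set `N_K` of
# the census IS `{t : Im σ_t(δ_K) < 0}` for an explicit generator `δ_K` of `K` — «`σ_t` acts as complex conjugation
# on `K`» is now a kernel statement (20 rows)

research route conditional on HC_CM; not a corollary; Q11.4-sentence-2 already refuted in dim ≥ 3.

Ring 2, WEIL-TYPE FAMILY-COVERAGE CENSUS (`HOME/WEIL-FAMILY-COVERAGE.md` `## b01`, blocks b01.23 (C)/(D), b01.34 (E)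
«the identification of the displayed `N_K` with conjugation on `K` is docstring-level», b01.36; owner ring2-b01),
part 27a of the `Ring2WeilCoverage*` series.  Parts 25/26/26b proved, for the Gauss-sum generators `δ` of
`ℚ(i), ℚ(√−2), ℚ(√−3), ℚ(√−7), ℚ(√−11)` and the real pieces `√2, √3, √5, √13`, that for an embedding `φ` of any field
`K ∋ ζ` (primitive `M`-th root) reading the unit residue `t` (`φ ζ = 𝐞(t)`), the sign of `Im φ(δ)` (resp. `Re`) is a
decidable predicate of `t mod f`.  Here, row by row, that predicate is identified (`decide`) with membership in the
finite set `N_K ⊂ (ℤ/M)ˣ` DISPLAYED in the census verdict theorems (parts 7, 9, 10, 12, 15–19, 22–24):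
**`nK_M_K`: `Im φ(δ_K) < 0 ↔ t ∈ N_K`**, with `δ_K ∈ ℤ[ζ]` an explicit element with `δ_K² = −d`
(`K = ℚ(√−d) = ℚ(δ_K)`; composite `d` via an imaginary piece times a real piece; the identity `δ_K² = −d` itself is
not needed and not restated here).  CONSEQUENCE: a CM type `Φ` of
`ℚ(ζ_M)` is «balanced for `N_K`» (`2|S_Φ ∩ N_K| = |S_Φ|`) iff exactly half of its embeddings send `δ_K` to the
lower half-plane, i.e. iff `Φ` restricts to `K` with multiplicities `(g/2, g/2)` — Weil type in the usual sense; so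
every census verdict theorem now reads, in the kernel, as a statement about `K`-Weil-type CM types.

HONEST FRAMING: finite checks (`decide`) on top of parts 25–26b; nothing here mentions Hodge classes, polarisations,
`W_K` or HC; `HC_CM` is used nowhere.  No `def`, no named fact, no `sorry`.

References: [cite: Aoki2002CMFermatType, §1 (p. 102)]; [cite: Washington1997, Lemma 4.8]; census b01.34 (E) / b01.36
(seat-derived).
-/

noncomputable section

open Complex Finset
open scoped Real

namespace Summit.HodgeConjecture.Ring2WeilCoverage.ResidueDictionaryRowsA

open Summit.HodgeConjecture.Ring2WeilCoverage.ResidueDictionary (im_mul_neg_iff_xor)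
open Summit.HodgeConjecture.Ring2WeilCoverage.ResidueDictionaryPieces
open Summit.HodgeConjecture.Ring2WeilCoverage.ResidueDictionaryPiecesB

/-- `𝐞(t) = exp(2πi t/M) ∈ ℂ` (`ZMod.toCircle`). -/
local notation3 (prettyPrint := false) "𝐞 " t:max => ((ZMod.toCircle t : Circle) : ℂ)

variable {K : Type} [Field K] {ζ : K}

/-! ### Level `21` -/

/-- **Row `(21, ℚ(√−3))`: `Im φ(δ) < 0 ↔ t ∈ N_K = {2, 5, 8, 11, 17, 20}`** for `δ = 1 + 2ζ^{M/3} (= √−3)`, `φ ζ = 𝐞(t)`, `t` a unit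
residue mod `21` — the displayed `N_K` of the census IS «the residues acting as complex conjugation on `ℚ(√−3)`».
research route conditional on HC_CM; not a corollary; Q11.4-sentence-2 already refuted in dim ≥ 3. [folklore] -/
theorem nK_twentyOne_sqrt_neg_three {φ : K →+* ℂ} {t : ZMod 21} (hφ : φ ζ = 𝐞 t) (ht : t.val.Coprime 21) :
    (φ ((1 + 2 * ζ ^ 7))).im < 0 ↔ t ∈ ({2, 5, 8, 11, 17, 20} : Finset (ZMod 21)) := by
  have k1 := im_embedding_sqrtNegThree_neg_iff (K := K) (n := 21) (by norm_num) hφ ht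
  simp only [Nat.reduceDiv] at k1
  have hdec : ∀ s : ZMod 21, s.val.Coprime 21 →
      ((({1} : Finset (ZMod 3)).image (· * ((ZMod.val s : ℕ) : ZMod 3)) = {2}) ↔ s ∈ ({2, 5, 8, 11, 17, 20} : Finset (ZMod 21))) := by
    decide
  exact k1.1.1.trans (hdec t ht)

/-- **Row `(21, ℚ(√−7))`: `Im φ(δ) < 0 ↔ t ∈ N_K = {5, 10, 13, 17, 19, 20}`** for `δ = 1 + 2(η+η²+η⁴), η = ζ^{M/7} (= √−7)`, `φ ζ = 𝐞(t)`, `t` a unit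
residue mod `21` — the displayed `N_K` of the census IS «the residues acting as complex conjugation on `ℚ(√−7)`».
research route conditional on HC_CM; not a corollary; Q11.4-sentence-2 already refuted in dim ≥ 3. [folklore] -/
theorem nK_twentyOne_sqrt_neg_seven {φ : K →+* ℂ} {t : ZMod 21} (hφ : φ ζ = 𝐞 t) (ht : t.val.Coprime 21) :
    (φ ((1 + 2 * (ζ ^ 3 + ζ ^ 6 + ζ ^ 12)))).im < 0 ↔ t ∈ ({5, 10, 13, 17, 19, 20} : Finset (ZMod 21)) := by
  have k1 := im_embedding_sqrtNegSeven_neg_iff (K := K) (n := 21) (by norm_num) hφ ht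
  simp only [Nat.reduceDiv, Nat.reduceMul] at k1
  have hdec : ∀ s : ZMod 21, s.val.Coprime 21 →
      ((({1, 2, 4} : Finset (ZMod 7)).image (· * ((ZMod.val s : ℕ) : ZMod 7)) = {3, 5, 6}) ↔ s ∈ ({5, 10, 13, 17, 19, 20} : Finset (ZMod 21))) := by
    decide
  exact k1.1.1.trans (hdec t ht)

/-! ### Level `28` -/

/-- **Row `(28, ℚ(i))`: `Im φ(δ) < 0 ↔ t ∈ N_K = {3, 11, 15, 19, 23, 27}`** for `δ = ζ^{M/4} (= i)`, `φ ζ = 𝐞(t)`, `t` a unit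
residue mod `28` — the displayed `N_K` of the census IS «the residues acting as complex conjugation on `ℚ(i)`».
research route conditional on HC_CM; not a corollary; Q11.4-sentence-2 already refuted in dim ≥ 3. [folklore] -/
theorem nK_twentyEight_sqrt_neg_one {φ : K →+* ℂ} {t : ZMod 28} (hφ : φ ζ = 𝐞 t) (ht : t.val.Coprime 28) :
    (φ (ζ ^ 7)).im < 0 ↔ t ∈ ({3, 11, 15, 19, 23, 27} : Finset (ZMod 28)) := by
  have k1 := im_embedding_sqrtNegOne_neg_iff (K := K) (n := 28) (by norm_num) hφ ht
  simp only [Nat.reduceDiv] at k1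
  have hdec : ∀ s : ZMod 28, s.val.Coprime 28 →
      ((({1} : Finset (ZMod 4)).image (· * ((ZMod.val s : ℕ) : ZMod 4)) = {3}) ↔ s ∈ ({3, 11, 15, 19, 23, 27} : Finset (ZMod 28))) := by
    decide
  exact k1.1.1.trans (hdec t ht)

/-- **Row `(28, ℚ(√−7))`: `Im φ(δ) < 0 ↔ t ∈ N_K = {3, 5, 13, 17, 19, 27}`** for `δ = 1 + 2(η+η²+η⁴), η = ζ^{M/7} (= √−7)`, `φ ζ = 𝐞(t)`, `t` a unit
residue mod `28` — the displayed `N_K` of the census IS «the residues acting as complex conjugation on `ℚ(√−7)`».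
research route conditional on HC_CM; not a corollary; Q11.4-sentence-2 already refuted in dim ≥ 3. [folklore] -/
theorem nK_twentyEight_sqrt_neg_seven {φ : K →+* ℂ} {t : ZMod 28} (hφ : φ ζ = 𝐞 t) (ht : t.val.Coprime 28) :
    (φ ((1 + 2 * (ζ ^ 4 + ζ ^ 8 + ζ ^ 16)))).im < 0 ↔ t ∈ ({3, 5, 13, 17, 19, 27} : Finset (ZMod 28)) := by
  have k1 := im_embedding_sqrtNegSeven_neg_iff (K := K) (n := 28) (by norm_num) hφ ht
  simp only [Nat.reduceDiv, Nat.reduceMul] at k1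
  have hdec : ∀ s : ZMod 28, s.val.Coprime 28 →
      ((({1, 2, 4} : Finset (ZMod 7)).image (· * ((ZMod.val s : ℕ) : ZMod 7)) = {3, 5, 6}) ↔ s ∈ ({3, 5, 13, 17, 19, 27} : Finset (ZMod 28))) := by
    decide
  exact k1.1.1.trans (hdec t ht)

/-! ### Level `32` -/

/-- **Row `(32, ℚ(i))`: `Im φ(δ) < 0 ↔ t ∈ N_K = {3, 7, 11, 15, 19, 23, 27, 31}`** for `δ = ζ^{M/4} (= i)`, `φ ζ = 𝐞(t)`, `t` a unit
residue mod `32` — the displayed `N_K` of the census IS «the residues acting as complex conjugation on `ℚ(i)`».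
research route conditional on HC_CM; not a corollary; Q11.4-sentence-2 already refuted in dim ≥ 3. [folklore] -/
theorem nK_thirtyTwo_sqrt_neg_one {φ : K →+* ℂ} {t : ZMod 32} (hφ : φ ζ = 𝐞 t) (ht : t.val.Coprime 32) :
    (φ (ζ ^ 8)).im < 0 ↔ t ∈ ({3, 7, 11, 15, 19, 23, 27, 31} : Finset (ZMod 32)) := by
  have k1 := im_embedding_sqrtNegOne_neg_iff (K := K) (n := 32) (by norm_num) hφ ht
  simp only [Nat.reduceDiv] at k1
  have hdec : ∀ s : ZMod 32, s.val.Coprime 32 →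
      ((({1} : Finset (ZMod 4)).image (· * ((ZMod.val s : ℕ) : ZMod 4)) = {3}) ↔ s ∈ ({3, 7, 11, 15, 19, 23, 27, 31} : Finset (ZMod 32))) := by
    decide
  exact k1.1.1.trans (hdec t ht)

/-- **Row `(32, ℚ(√−2))`: `Im φ(δ) < 0 ↔ t ∈ N_K = {5, 7, 13, 15, 21, 23, 29, 31}`** for `δ = ζ^{M/8} + ζ^{3M/8} (= √−2)`, `φ ζ = 𝐞(t)`, `t` a unit
residue mod `32` — the displayed `N_K` of the census IS «the residues acting as complex conjugation on `ℚ(√−2)`».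
research route conditional on HC_CM; not a corollary; Q11.4-sentence-2 already refuted in dim ≥ 3. [folklore] -/
theorem nK_thirtyTwo_sqrt_neg_two {φ : K →+* ℂ} {t : ZMod 32} (hφ : φ ζ = 𝐞 t) (ht : t.val.Coprime 32) :
    (φ ((ζ ^ 4 + ζ ^ 12))).im < 0 ↔ t ∈ ({5, 7, 13, 15, 21, 23, 29, 31} : Finset (ZMod 32)) := by
  have k1 := im_embedding_sqrtNegTwo_neg_iff (K := K) (n := 32) (by norm_num) hφ ht
  simp only [Nat.reduceDiv, Nat.reduceMul] at k1
  have hdec : ∀ s : ZMod 32, s.val.Coprime 32 →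
      ((({1, 3} : Finset (ZMod 8)).image (· * ((ZMod.val s : ℕ) : ZMod 8)) = {5, 7}) ↔ s ∈ ({5, 7, 13, 15, 21, 23, 29, 31} : Finset (ZMod 32))) := by
    decide
  exact k1.1.1.trans (hdec t ht)

/-! ### Level `36` -/

/-- **Row `(36, ℚ(i))`: `Im φ(δ) < 0 ↔ t ∈ N_K = {7, 11, 19, 23, 31, 35}`** for `δ = ζ^{M/4} (= i)`, `φ ζ = 𝐞(t)`, `t` a unit
residue mod `36` — the displayed `N_K` of the census IS «the residues acting as complex conjugation on `ℚ(i)`».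
research route conditional on HC_CM; not a corollary; Q11.4-sentence-2 already refuted in dim ≥ 3. [folklore] -/
theorem nK_thirtySix_sqrt_neg_one {φ : K →+* ℂ} {t : ZMod 36} (hφ : φ ζ = 𝐞 t) (ht : t.val.Coprime 36) :
    (φ (ζ ^ 9)).im < 0 ↔ t ∈ ({7, 11, 19, 23, 31, 35} : Finset (ZMod 36)) := by
  have k1 := im_embedding_sqrtNegOne_neg_iff (K := K) (n := 36) (by norm_num) hφ ht
  simp only [Nat.reduceDiv] at k1
  have hdec : ∀ s : ZMod 36, s.val.Coprime 36 →
      ((({1} : Finset (ZMod 4)).image (· * ((ZMod.val s : ℕ) : ZMod 4)) = {3}) ↔ s ∈ ({7, 11, 19, 23, 31, 35} : Finset (ZMod 36))) := by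
    decide
  exact k1.1.1.trans (hdec t ht)

/-- **Row `(36, ℚ(√−3))`: `Im φ(δ) < 0 ↔ t ∈ N_K = {5, 11, 17, 23, 29, 35}`** for `δ = 1 + 2ζ^{M/3} (= √−3)`, `φ ζ = 𝐞(t)`, `t` a unit
residue mod `36` — the displayed `N_K` of the census IS «the residues acting as complex conjugation on `ℚ(√−3)`».
research route conditional on HC_CM; not a corollary; Q11.4-sentence-2 already refuted in dim ≥ 3. [folklore] -/
theorem nK_thirtySix_sqrt_neg_three {φ : K →+* ℂ} {t : ZMod 36} (hφ : φ ζ = 𝐞 t) (ht : t.val.Coprime 36) :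
    (φ ((1 + 2 * ζ ^ 12))).im < 0 ↔ t ∈ ({5, 11, 17, 23, 29, 35} : Finset (ZMod 36)) := by
  have k1 := im_embedding_sqrtNegThree_neg_iff (K := K) (n := 36) (by norm_num) hφ ht
  simp only [Nat.reduceDiv] at k1
  have hdec : ∀ s : ZMod 36, s.val.Coprime 36 →
      ((({1} : Finset (ZMod 3)).image (· * ((ZMod.val s : ℕ) : ZMod 3)) = {2}) ↔ s ∈ ({5, 11, 17, 23, 29, 35} : Finset (ZMod 36))) := by
    decide
  exact k1.1.1.trans (hdec t ht)

/-! ### Level `40` -/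

/-- **Row `(40, ℚ(i))`: `Im φ(δ) < 0 ↔ t ∈ N_K = {3, 7, 11, 19, 23, 27, 31, 39}`** for `δ = ζ^{M/4} (= i)`, `φ ζ = 𝐞(t)`, `t` a unit
residue mod `40` — the displayed `N_K` of the census IS «the residues acting as complex conjugation on `ℚ(i)`».
research route conditional on HC_CM; not a corollary; Q11.4-sentence-2 already refuted in dim ≥ 3. [folklore] -/
theorem nK_forty_sqrt_neg_one {φ : K →+* ℂ} {t : ZMod 40} (hφ : φ ζ = 𝐞 t) (ht : t.val.Coprime 40) :
    (φ (ζ ^ 10)).im < 0 ↔ t ∈ ({3, 7, 11, 19, 23, 27, 31, 39} : Finset (ZMod 40)) := by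
  have k1 := im_embedding_sqrtNegOne_neg_iff (K := K) (n := 40) (by norm_num) hφ ht
  simp only [Nat.reduceDiv] at k1
  have hdec : ∀ s : ZMod 40, s.val.Coprime 40 →
      ((({1} : Finset (ZMod 4)).image (· * ((ZMod.val s : ℕ) : ZMod 4)) = {3}) ↔ s ∈ ({3, 7, 11, 19, 23, 27, 31, 39} : Finset (ZMod 40))) := by
    decide
  exact k1.1.1.trans (hdec t ht)

/-- **Row `(40, ℚ(√−2))`: `Im φ(δ) < 0 ↔ t ∈ N_K = {7, 13, 21, 23, 29, 31, 37, 39}`** for `δ = ζ^{M/8} + ζ^{3M/8} (= √−2)`, `φ ζ = 𝐞(t)`, `t` a unit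
residue mod `40` — the displayed `N_K` of the census IS «the residues acting as complex conjugation on `ℚ(√−2)`».
research route conditional on HC_CM; not a corollary; Q11.4-sentence-2 already refuted in dim ≥ 3. [folklore] -/
theorem nK_forty_sqrt_neg_two {φ : K →+* ℂ} {t : ZMod 40} (hφ : φ ζ = 𝐞 t) (ht : t.val.Coprime 40) :
    (φ ((ζ ^ 5 + ζ ^ 15))).im < 0 ↔ t ∈ ({7, 13, 21, 23, 29, 31, 37, 39} : Finset (ZMod 40)) := by
  have k1 := im_embedding_sqrtNegTwo_neg_iff (K := K) (n := 40) (by norm_num) hφ ht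
  simp only [Nat.reduceDiv, Nat.reduceMul] at k1
  have hdec : ∀ s : ZMod 40, s.val.Coprime 40 →
      ((({1, 3} : Finset (ZMod 8)).image (· * ((ZMod.val s : ℕ) : ZMod 8)) = {5, 7}) ↔ s ∈ ({7, 13, 21, 23, 29, 31, 37, 39} : Finset (ZMod 40))) := by
    decide
  exact k1.1.1.trans (hdec t ht)

/-- **Row `(40, ℚ(√−5))`: `Im φ(δ) < 0 ↔ t ∈ N_K = {11, 13, 17, 19, 31, 33, 37, 39}`** for `δ = ζ^{M/4}·(1 + 2(η+η⁴)), η = ζ^{M/5} (= i√5)`, `φ ζ = 𝐞(t)`, `t` a unit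
residue mod `40` (imaginary piece × real piece, part 25's `im_mul_neg_iff_xor`) — the displayed `N_K` of the census
IS «the residues acting as complex conjugation on `ℚ(√−5)`».
research route conditional on HC_CM; not a corollary; Q11.4-sentence-2 already refuted in dim ≥ 3. [folklore] -/
theorem nK_forty_sqrt_neg_five {φ : K →+* ℂ} {t : ZMod 40} (hφ : φ ζ = 𝐞 t) (ht : t.val.Coprime 40) :
    (φ (ζ ^ 10 * (1 + 2 * (ζ ^ 8 + ζ ^ 32)))).im < 0 ↔ t ∈ ({11, 13, 17, 19, 31, 33, 37, 39} : Finset (ZMod 40)) := by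
  have k1 := im_embedding_sqrtNegOne_neg_iff (K := K) (n := 40) (by norm_num) hφ ht
  have k2 := re_embedding_sqrtFive_neg_iff (K := K) (n := 40) (by norm_num) hφ ht
  simp only [Nat.reduceDiv, Nat.reduceMul] at k1 k2
  obtain ⟨⟨h1, h1'⟩, h1''⟩ := k1
  obtain ⟨⟨h2, h2'⟩, h2''⟩ := k2
  rw [map_mul, (im_mul_neg_iff_xor h1'' h2'' h1' h2').1.1, h1, h2]
  have hdec : ∀ s : ZMod 40, s.val.Coprime 40 →
      ((((({1} : Finset (ZMod 4)).image (· * ((ZMod.val s : ℕ) : ZMod 4)) = {3}) ∧ ¬ (({1, 4} : Finset (ZMod 5)).image (· * ((ZMod.val s : ℕ) : ZMod 5)) = {2, 3})) ∨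
        ((({1, 4} : Finset (ZMod 5)).image (· * ((ZMod.val s : ℕ) : ZMod 5)) = {2, 3}) ∧ ¬ (({1} : Finset (ZMod 4)).image (· * ((ZMod.val s : ℕ) : ZMod 4)) = {3}))) ↔ s ∈ ({11, 13, 17, 19, 31, 33, 37, 39} : Finset (ZMod 40))) := by
    decide
  exact hdec t ht

/-- **Row `(40, ℚ(√−10))`: `Im φ(δ) < 0 ↔ t ∈ N_K = {3, 17, 21, 27, 29, 31, 33, 39}`** for `δ = (ζ^{M/8}+ζ^{3M/8})(1+2(η+η⁴)), η = ζ^{M/5} (= √−2·√5)`, `φ ζ = 𝐞(t)`, `t` a unit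
residue mod `40` (imaginary piece × real piece, part 25's `im_mul_neg_iff_xor`) — the displayed `N_K` of the census
IS «the residues acting as complex conjugation on `ℚ(√−10)`».
research route conditional on HC_CM; not a corollary; Q11.4-sentence-2 already refuted in dim ≥ 3. [folklore] -/
theorem nK_forty_sqrt_neg_ten {φ : K →+* ℂ} {t : ZMod 40} (hφ : φ ζ = 𝐞 t) (ht : t.val.Coprime 40) :
    (φ ((ζ ^ 5 + ζ ^ 15) * (1 + 2 * (ζ ^ 8 + ζ ^ 32)))).im < 0 ↔ t ∈ ({3, 17, 21, 27, 29, 31, 33, 39} : Finset (ZMod 40)) := by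
  have k1 := im_embedding_sqrtNegTwo_neg_iff (K := K) (n := 40) (by norm_num) hφ ht
  have k2 := re_embedding_sqrtFive_neg_iff (K := K) (n := 40) (by norm_num) hφ ht
  simp only [Nat.reduceDiv, Nat.reduceMul] at k1 k2
  obtain ⟨⟨h1, h1'⟩, h1''⟩ := k1
  obtain ⟨⟨h2, h2'⟩, h2''⟩ := k2
  rw [map_mul, (im_mul_neg_iff_xor h1'' h2'' h1' h2').1.1, h1, h2]
  have hdec : ∀ s : ZMod 40, s.val.Coprime 40 →
      ((((({1, 3} : Finset (ZMod 8)).image (· * ((ZMod.val s : ℕ) : ZMod 8)) = {5, 7}) ∧ ¬ (({1, 4} : Finset (ZMod 5)).image (· * ((ZMod.val s : ℕ) : ZMod 5)) = {2, 3})) ∨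
        ((({1, 4} : Finset (ZMod 5)).image (· * ((ZMod.val s : ℕ) : ZMod 5)) = {2, 3}) ∧ ¬ (({1, 3} : Finset (ZMod 8)).image (· * ((ZMod.val s : ℕ) : ZMod 8)) = {5, 7}))) ↔ s ∈ ({3, 17, 21, 27, 29, 31, 33, 39} : Finset (ZMod 40))) := by
    decide
  exact hdec t ht

/-! ### Level `48` -/

/-- **Row `(48, ℚ(i))`: `Im φ(δ) < 0 ↔ t ∈ N_K = {7, 11, 19, 23, 31, 35, 43, 47}`** for `δ = ζ^{M/4} (= i)`, `φ ζ = 𝐞(t)`, `t` a unit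
residue mod `48` — the displayed `N_K` of the census IS «the residues acting as complex conjugation on `ℚ(i)`».
research route conditional on HC_CM; not a corollary; Q11.4-sentence-2 already refuted in dim ≥ 3. [folklore] -/
theorem nK_fortyEight_sqrt_neg_one {φ : K →+* ℂ} {t : ZMod 48} (hφ : φ ζ = 𝐞 t) (ht : t.val.Coprime 48) :
    (φ (ζ ^ 12)).im < 0 ↔ t ∈ ({7, 11, 19, 23, 31, 35, 43, 47} : Finset (ZMod 48)) := by
  have k1 := im_embedding_sqrtNegOne_neg_iff (K := K) (n := 48) (by norm_num) hφ ht
  simp only [Nat.reduceDiv] at k1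
  have hdec : ∀ s : ZMod 48, s.val.Coprime 48 →
      ((({1} : Finset (ZMod 4)).image (· * ((ZMod.val s : ℕ) : ZMod 4)) = {3}) ↔ s ∈ ({7, 11, 19, 23, 31, 35, 43, 47} : Finset (ZMod 48))) := by
    decide
  exact k1.1.1.trans (hdec t ht)

/-- **Row `(48, ℚ(√−2))`: `Im φ(δ) < 0 ↔ t ∈ N_K = {5, 7, 13, 23, 29, 31, 37, 47}`** for `δ = ζ^{M/8} + ζ^{3M/8} (= √−2)`, `φ ζ = 𝐞(t)`, `t` a unit
residue mod `48` — the displayed `N_K` of the census IS «the residues acting as complex conjugation on `ℚ(√−2)`».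
research route conditional on HC_CM; not a corollary; Q11.4-sentence-2 already refuted in dim ≥ 3. [folklore] -/
theorem nK_fortyEight_sqrt_neg_two {φ : K →+* ℂ} {t : ZMod 48} (hφ : φ ζ = 𝐞 t) (ht : t.val.Coprime 48) :
    (φ ((ζ ^ 6 + ζ ^ 18))).im < 0 ↔ t ∈ ({5, 7, 13, 23, 29, 31, 37, 47} : Finset (ZMod 48)) := by
  have k1 := im_embedding_sqrtNegTwo_neg_iff (K := K) (n := 48) (by norm_num) hφ ht
  simp only [Nat.reduceDiv, Nat.reduceMul] at k1
  have hdec : ∀ s : ZMod 48, s.val.Coprime 48 →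
      ((({1, 3} : Finset (ZMod 8)).image (· * ((ZMod.val s : ℕ) : ZMod 8)) = {5, 7}) ↔ s ∈ ({5, 7, 13, 23, 29, 31, 37, 47} : Finset (ZMod 48))) := by
    decide
  exact k1.1.1.trans (hdec t ht)

/-- **Row `(48, ℚ(√−3))`: `Im φ(δ) < 0 ↔ t ∈ N_K = {5, 11, 17, 23, 29, 35, 41, 47}`** for `δ = 1 + 2ζ^{M/3} (= √−3)`, `φ ζ = 𝐞(t)`, `t` a unit
residue mod `48` — the displayed `N_K` of the census IS «the residues acting as complex conjugation on `ℚ(√−3)`».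
research route conditional on HC_CM; not a corollary; Q11.4-sentence-2 already refuted in dim ≥ 3. [folklore] -/
theorem nK_fortyEight_sqrt_neg_three {φ : K →+* ℂ} {t : ZMod 48} (hφ : φ ζ = 𝐞 t) (ht : t.val.Coprime 48) :
    (φ ((1 + 2 * ζ ^ 16))).im < 0 ↔ t ∈ ({5, 11, 17, 23, 29, 35, 41, 47} : Finset (ZMod 48)) := by
  have k1 := im_embedding_sqrtNegThree_neg_iff (K := K) (n := 48) (by norm_num) hφ ht
  simp only [Nat.reduceDiv] at k1
  have hdec : ∀ s : ZMod 48, s.val.Coprime 48 →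
      ((({1} : Finset (ZMod 3)).image (· * ((ZMod.val s : ℕ) : ZMod 3)) = {2}) ↔ s ∈ ({5, 11, 17, 23, 29, 35, 41, 47} : Finset (ZMod 48))) := by
    decide
  exact k1.1.1.trans (hdec t ht)

/-- **Row `(48, ℚ(√−6))`: `Im φ(δ) < 0 ↔ t ∈ N_K = {13, 17, 19, 23, 37, 41, 43, 47}`** for `δ = (ζ^{M/8}+ζ^{3M/8})(ζ^{M/12}+ζ^{11M/12}) (= √−2·√3)`, `φ ζ = 𝐞(t)`, `t` a unit
residue mod `48` (imaginary piece × real piece, part 25's `im_mul_neg_iff_xor`) — the displayed `N_K` of the census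
IS «the residues acting as complex conjugation on `ℚ(√−6)`».
research route conditional on HC_CM; not a corollary; Q11.4-sentence-2 already refuted in dim ≥ 3. [folklore] -/
theorem nK_fortyEight_sqrt_neg_six {φ : K →+* ℂ} {t : ZMod 48} (hφ : φ ζ = 𝐞 t) (ht : t.val.Coprime 48) :
    (φ ((ζ ^ 6 + ζ ^ 18) * (ζ ^ 4 + ζ ^ 44))).im < 0 ↔ t ∈ ({13, 17, 19, 23, 37, 41, 43, 47} : Finset (ZMod 48)) := by
  have k1 := im_embedding_sqrtNegTwo_neg_iff (K := K) (n := 48) (by norm_num) hφ ht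
  have k2 := re_embedding_sqrtThree_neg_iff (K := K) (n := 48) (by norm_num) hφ ht
  simp only [Nat.reduceDiv, Nat.reduceMul] at k1 k2
  obtain ⟨⟨h1, h1'⟩, h1''⟩ := k1
  obtain ⟨⟨h2, h2'⟩, h2''⟩ := k2
  rw [map_mul, (im_mul_neg_iff_xor h1'' h2'' h1' h2').1.1, h1, h2]
  have hdec : ∀ s : ZMod 48, s.val.Coprime 48 →
      ((((({1, 3} : Finset (ZMod 8)).image (· * ((ZMod.val s : ℕ) : ZMod 8)) = {5, 7}) ∧ ¬ (({1, 11} : Finset (ZMod 12)).image (· * ((ZMod.val s : ℕ) : ZMod 12)) = {5, 7})) ∨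
        ((({1, 11} : Finset (ZMod 12)).image (· * ((ZMod.val s : ℕ) : ZMod 12)) = {5, 7}) ∧ ¬ (({1, 3} : Finset (ZMod 8)).image (· * ((ZMod.val s : ℕ) : ZMod 8)) = {5, 7}))) ↔ s ∈ ({13, 17, 19, 23, 37, 41, 43, 47} : Finset (ZMod 48))) := by
    decide
  exact hdec t ht

/-! ### Level `60` -/

/-- **Row `(60, ℚ(i))`: `Im φ(δ) < 0 ↔ t ∈ N_K = {7, 11, 19, 23, 31, 43, 47, 59}`** for `δ = ζ^{M/4} (= i)`, `φ ζ = 𝐞(t)`, `t` a unit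
residue mod `60` — the displayed `N_K` of the census IS «the residues acting as complex conjugation on `ℚ(i)`».
research route conditional on HC_CM; not a corollary; Q11.4-sentence-2 already refuted in dim ≥ 3. [folklore] -/
theorem nK_sixty_sqrt_neg_one {φ : K →+* ℂ} {t : ZMod 60} (hφ : φ ζ = 𝐞 t) (ht : t.val.Coprime 60) :
    (φ (ζ ^ 15)).im < 0 ↔ t ∈ ({7, 11, 19, 23, 31, 43, 47, 59} : Finset (ZMod 60)) := by
  have k1 := im_embedding_sqrtNegOne_neg_iff (K := K) (n := 60) (by norm_num) hφ ht
  simp only [Nat.reduceDiv] at k1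
  have hdec : ∀ s : ZMod 60, s.val.Coprime 60 →
      ((({1} : Finset (ZMod 4)).image (· * ((ZMod.val s : ℕ) : ZMod 4)) = {3}) ↔ s ∈ ({7, 11, 19, 23, 31, 43, 47, 59} : Finset (ZMod 60))) := by
    decide
  exact k1.1.1.trans (hdec t ht)

/-- **Row `(60, ℚ(√−3))`: `Im φ(δ) < 0 ↔ t ∈ N_K = {11, 17, 23, 29, 41, 47, 53, 59}`** for `δ = 1 + 2ζ^{M/3} (= √−3)`, `φ ζ = 𝐞(t)`, `t` a unit
residue mod `60` — the displayed `N_K` of the census IS «the residues acting as complex conjugation on `ℚ(√−3)`».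
research route conditional on HC_CM; not a corollary; Q11.4-sentence-2 already refuted in dim ≥ 3. [folklore] -/
theorem nK_sixty_sqrt_neg_three {φ : K →+* ℂ} {t : ZMod 60} (hφ : φ ζ = 𝐞 t) (ht : t.val.Coprime 60) :
    (φ ((1 + 2 * ζ ^ 20))).im < 0 ↔ t ∈ ({11, 17, 23, 29, 41, 47, 53, 59} : Finset (ZMod 60)) := by
  have k1 := im_embedding_sqrtNegThree_neg_iff (K := K) (n := 60) (by norm_num) hφ ht
  simp only [Nat.reduceDiv] at k1
  have hdec : ∀ s : ZMod 60, s.val.Coprime 60 →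
      ((({1} : Finset (ZMod 3)).image (· * ((ZMod.val s : ℕ) : ZMod 3)) = {2}) ↔ s ∈ ({11, 17, 23, 29, 41, 47, 53, 59} : Finset (ZMod 60))) := by
    decide
  exact k1.1.1.trans (hdec t ht)

/-- **Row `(60, ℚ(√−5))`: `Im φ(δ) < 0 ↔ t ∈ N_K = {11, 13, 17, 19, 31, 37, 53, 59}`** for `δ = ζ^{M/4}·(1 + 2(η+η⁴)), η = ζ^{M/5} (= i√5)`, `φ ζ = 𝐞(t)`, `t` a unit
residue mod `60` (imaginary piece × real piece, part 25's `im_mul_neg_iff_xor`) — the displayed `N_K` of the census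
IS «the residues acting as complex conjugation on `ℚ(√−5)`».
research route conditional on HC_CM; not a corollary; Q11.4-sentence-2 already refuted in dim ≥ 3. [folklore] -/
theorem nK_sixty_sqrt_neg_five {φ : K →+* ℂ} {t : ZMod 60} (hφ : φ ζ = 𝐞 t) (ht : t.val.Coprime 60) :
    (φ (ζ ^ 15 * (1 + 2 * (ζ ^ 12 + ζ ^ 48)))).im < 0 ↔ t ∈ ({11, 13, 17, 19, 31, 37, 53, 59} : Finset (ZMod 60)) := by
  have k1 := im_embedding_sqrtNegOne_neg_iff (K := K) (n := 60) (by norm_num) hφ ht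
  have k2 := re_embedding_sqrtFive_neg_iff (K := K) (n := 60) (by norm_num) hφ ht
  simp only [Nat.reduceDiv, Nat.reduceMul] at k1 k2
  obtain ⟨⟨h1, h1'⟩, h1''⟩ := k1
  obtain ⟨⟨h2, h2'⟩, h2''⟩ := k2
  rw [map_mul, (im_mul_neg_iff_xor h1'' h2'' h1' h2').1.1, h1, h2]
  have hdec : ∀ s : ZMod 60, s.val.Coprime 60 →
      ((((({1} : Finset (ZMod 4)).image (· * ((ZMod.val s : ℕ) : ZMod 4)) = {3}) ∧ ¬ (({1, 4} : Finset (ZMod 5)).image (· * ((ZMod.val s : ℕ) : ZMod 5)) = {2, 3})) ∨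
        ((({1, 4} : Finset (ZMod 5)).image (· * ((ZMod.val s : ℕ) : ZMod 5)) = {2, 3}) ∧ ¬ (({1} : Finset (ZMod 4)).image (· * ((ZMod.val s : ℕ) : ZMod 4)) = {3}))) ↔ s ∈ ({11, 13, 17, 19, 31, 37, 53, 59} : Finset (ZMod 60))) := by
    decide
  exact hdec t ht

/-- **Row `(60, ℚ(√−15))`: `Im φ(δ) < 0 ↔ t ∈ N_K = {7, 11, 13, 29, 37, 41, 43, 59}`** for `δ = (1+2ζ^{M/3})(1+2(η+η⁴)), η = ζ^{M/5} (= √−3·√5)`, `φ ζ = 𝐞(t)`, `t` a unit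
residue mod `60` (imaginary piece × real piece, part 25's `im_mul_neg_iff_xor`) — the displayed `N_K` of the census
IS «the residues acting as complex conjugation on `ℚ(√−15)`».
research route conditional on HC_CM; not a corollary; Q11.4-sentence-2 already refuted in dim ≥ 3. [folklore] -/
theorem nK_sixty_sqrt_neg_fifteen {φ : K →+* ℂ} {t : ZMod 60} (hφ : φ ζ = 𝐞 t) (ht : t.val.Coprime 60) :
    (φ ((1 + 2 * ζ ^ 20) * (1 + 2 * (ζ ^ 12 + ζ ^ 48)))).im < 0 ↔ t ∈ ({7, 11, 13, 29, 37, 41, 43, 59} : Finset (ZMod 60)) := by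
  have k1 := im_embedding_sqrtNegThree_neg_iff (K := K) (n := 60) (by norm_num) hφ ht
  have k2 := re_embedding_sqrtFive_neg_iff (K := K) (n := 60) (by norm_num) hφ ht
  simp only [Nat.reduceDiv, Nat.reduceMul] at k1 k2
  obtain ⟨⟨h1, h1'⟩, h1''⟩ := k1
  obtain ⟨⟨h2, h2'⟩, h2''⟩ := k2
  rw [map_mul, (im_mul_neg_iff_xor h1'' h2'' h1' h2').1.1, h1, h2]
  have hdec : ∀ s : ZMod 60, s.val.Coprime 60 →
      ((((({1} : Finset (ZMod 3)).image (· * ((ZMod.val s : ℕ) : ZMod 3)) = {2}) ∧ ¬ (({1, 4} : Finset (ZMod 5)).image (· * ((ZMod.val s : ℕ) : ZMod 5)) = {2, 3})) ∨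
        ((({1, 4} : Finset (ZMod 5)).image (· * ((ZMod.val s : ℕ) : ZMod 5)) = {2, 3}) ∧ ¬ (({1} : Finset (ZMod 3)).image (· * ((ZMod.val s : ℕ) : ZMod 3)) = {2}))) ↔ s ∈ ({7, 11, 13, 29, 37, 41, 43, 59} : Finset (ZMod 60))) := by
    decide
  exact hdec t ht

end Summit.HodgeConjecture.Ring2WeilCoverage.ResidueDictionaryRowsA

end
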